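import Literature.Uncategorized.Crux
import Literature.Topology.FourManifolds.Rasmussen
import Literature.Topology.FourManifolds.LeeRasmussen
import Literature.Topology.FourManifolds.GaussDiagramsRegularPosition
import Literature.Topology.FourManifolds.RasmussenConcordanceProofs
import Literature.Topology.FourManifolds.KnotsIsotopyProofs
import Literature.Topology.FourManifolds.SliceRibbonIsotopyProofs
import Summits.SmoothPoincare4.SmoothPoincare4.Theorems.ZseCruxRasmussen.Negative.Parity
import Summits.SmoothPoincare4.SmoothPoincare4.Theorems.ZseSVanishesOnPairs.Negative.MirrorClosure
import HarnessLib

/-!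
# `ZseCruxRasmussen` — negative knowledge VI: sign/size normalisation of the witness; the unknot seed is dead

Refuter support lemmas for crux `stmt-SmoothPoincare4-0366` (`Literature.Uncategorized.Crux`: knots `K, K'` with a
common `0`-surgery `Y`, `K` smoothly slice, `s(K') ≠ 0`), from the standing disprover's work file
`Summits/SmoothPoincare4/SmoothPoincare4/Cruxes/ZseCruxRasmussen/Disproof.lean` §11–§12 (cycle 3):

* `crux_iff_pos`, `crux_iff_two_le`, `crux_iff_le_neg_two` — UNCONDITIONAL: the crux is equivalent to each of its
  signed forms `0 < s(K')`, `2 ≤ s(K')`, `s(K') ≤ -2`.  Sign: the four pair hypotheses are closed under simultaneous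
  mirror image with `s ↦ -s` (the sibling disprover's PROVED `ZseSVanishesOnPairs.Negative.pair_mirror` —
  `IsIntegralSurgery` is orientation-blind, sliceness is mirror-invariant, `s(K̄) = -s(K)`); size: parity
  (`hasRasmussenInvariant_even`, `Negative/Parity.lean`).  A search may fix the sign; a disproof may assume `s(K') ≥ 2`.
* `crux_false_of_unknotSeed` — no witness is seeded by `K` = unknot, GIVEN Property R in friend form (hypothesis
  `hPR`: a knot sharing a `0`-surgery, over the crux's own `ℝ³`-charted `Y`, with the unknot is unknotted — Gabai 1987
  Cor. 8.3 / Remark 8.5; the tree's named fact `isUnknot_of_isIntegralSurgery_zero` is the `S² × S¹` form, and the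
  passage needs transport of surgery presentations across models on different vector spaces, absent from the tree)
  and Rasmussen's Theorem 1 (`eq_zero_of_isSmoothlySlice`): the friend is unknotted, hence slice
  (`Knot.IsUnknot.isSmoothlySlice` with the discharged `Knot.IsSmoothlySlice.of_isIsotopic_holds`), hence `s = 0`.
* `rasmussen_eq_zero_of_amphichiral`, `crux_partner_chiral` — amphichiral partners are dead, GIVEN single-valuedness of
  `s` (named facts `Knot.reidemeister`, `GaussDiagram.rasmussenInvariant_eq_of_equiv`; existence, mirror and isotopy
  transport are proved): `K' ≅ K̄'` forces `s(K') = -s(K') = 0`.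
No definitions; no route item is concluded positively (only equivalent forms of the open statement and negative instances).
References: Rasmussen 2010 Prop. 3.3, §3.5, Thm. 1 [Rasmussen2010]; Gompf–Stipsicz 1999 §5.1 [GompfStipsicz1999];
Gabai 1987 Cor. 8.3 [GabaiJDG1987].
-/

noncomputable section

set_option linter.dupNamespace false

namespace Summit.SmoothPoincare4.SmoothPoincare4.Theorems.ZseCruxRasmussen.Negative

open scoped Manifold ContDiff
open Literature.Topology.FourManifolds Literature.Uncategorized
open Summit.SmoothPoincare4.SmoothPoincare4.Theorems.ZseSVanishesOnPairs.Negative (pair_mirror)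

/-- **The crux is equivalent to its positive form** (`0 < s(K')`): mirror a negative witness — `(K̄, K̄', Y, -s)`
is again a witness (`pair_mirror`, PROVED).  Unconditional. [cite: Rasmussen2010, §3.5] [cite: GompfStipsicz1999, §5.1] -/
theorem crux_iff_pos : Crux ↔
    ∃ (K K' : Knot) (Y : Type) (_ : TopologicalSpace Y) (_ : ChartedSpace (EuclideanSpace ℝ (Fin 3)) Y)
      (s : ℤ), IsIntegralSurgery (𝓡 3) Y K 0 ∧ IsIntegralSurgery (𝓡 3) Y K' 0 ∧ K.IsSmoothlySlice ∧
        K'.HasRasmussenInvariant s ∧ 0 < s := by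
  constructor
  · rintro ⟨K, K', Y, _, _, s, hK, hK', hsl, hs, hs0⟩
    rcases lt_or_gt_of_ne hs0 with h | h
    · obtain ⟨m1, m2, m3, m4⟩ := pair_mirror hK hK' hsl hs
      exact ⟨K.mirror, K'.mirror, Y, _, _, -s, m1, m2, m3, m4, by omega⟩
    · exact ⟨K, K', Y, _, _, s, hK, hK', hsl, hs, h⟩
  · rintro ⟨K, K', Y, _, _, s, hK, hK', hsl, hs, hs0⟩
    exact ⟨K, K', Y, _, _, s, hK, hK', hsl, hs, hs0.ne'⟩

/-- **The crux is equivalent to its form with witness clause `2 ≤ s(K')`** (sign by mirror closure, size by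
parity).  Unconditional. [cite: Rasmussen2010, Prop. 3.3] -/
theorem crux_iff_two_le : Crux ↔
    ∃ (K K' : Knot) (Y : Type) (_ : TopologicalSpace Y) (_ : ChartedSpace (EuclideanSpace ℝ (Fin 3)) Y)
      (s : ℤ), IsIntegralSurgery (𝓡 3) Y K 0 ∧ IsIntegralSurgery (𝓡 3) Y K' 0 ∧ K.IsSmoothlySlice ∧
        K'.HasRasmussenInvariant s ∧ 2 ≤ s := by
  rw [crux_iff_pos]
  constructor
  · rintro ⟨K, K', Y, _, _, s, hK, hK', hsl, hs, hs0⟩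
    refine ⟨K, K', Y, _, _, s, hK, hK', hsl, hs, ?_⟩
    obtain ⟨t, rfl⟩ := hasRasmussenInvariant_even hs
    omega
  · rintro ⟨K, K', Y, _, _, s, hK, hK', hsl, hs, hs2⟩
    exact ⟨K, K', Y, _, _, s, hK, hK', hsl, hs, by omega⟩

/-- Dually, **the crux is equivalent to its negative form** (`s(K') ≤ -2`).  Unconditional. [cite: Rasmussen2010, Prop. 3.3] -/
theorem crux_iff_le_neg_two : Crux ↔
    ∃ (K K' : Knot) (Y : Type) (_ : TopologicalSpace Y) (_ : ChartedSpace (EuclideanSpace ℝ (Fin 3)) Y)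
      (s : ℤ), IsIntegralSurgery (𝓡 3) Y K 0 ∧ IsIntegralSurgery (𝓡 3) Y K' 0 ∧ K.IsSmoothlySlice ∧
        K'.HasRasmussenInvariant s ∧ s ≤ -2 := by
  rw [crux_iff_two_le]
  constructor
  · rintro ⟨K, K', Y, _, _, s, hK, hK', hsl, hs, hs2⟩
    obtain ⟨m1, m2, m3, m4⟩ := pair_mirror hK hK' hsl hs
    exact ⟨K.mirror, K'.mirror, Y, _, _, -s, m1, m2, m3, m4, by omega⟩
  · rintro ⟨K, K', Y, _, _, s, hK, hK', hsl, hs, hs2⟩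
    obtain ⟨m1, m2, m3, m4⟩ := pair_mirror hK hK' hsl hs
    exact ⟨K.mirror, K'.mirror, Y, _, _, -s, m1, m2, m3, m4, by omega⟩

/-- **No witness is seeded by the unknot**, GIVEN Property R in friend form (`hPR`, Gabai: a `0`-friend of the
unknot is unknotted) and Rasmussen's Theorem 1 (`hR`): the friend `K'` is unknotted, hence slice, hence
`s(K') = 0`.  So every seed `K` is a non-trivial slice knot (and, by `crux_false_of_concordant`, not concordant to
its partner). [cite: GabaiJDG1987, Cor. 8.3 and Remark 8.5] [cite: Rasmussen2010, Thm. 1] -/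
theorem crux_false_of_unknotSeed
    (hPR : ∀ (K' : Knot) (Y : Type) [TopologicalSpace Y] [ChartedSpace (EuclideanSpace ℝ (Fin 3)) Y],
      IsIntegralSurgery (𝓡 3) Y unknot 0 → IsIntegralSurgery (𝓡 3) Y K' 0 → K'.IsUnknot)
    (hR : eq_zero_of_isSmoothlySlice) :
    ¬ ∃ (K' : Knot) (Y : Type) (_ : TopologicalSpace Y) (_ : ChartedSpace (EuclideanSpace ℝ (Fin 3)) Y)
        (s : ℤ), IsIntegralSurgery (𝓡 3) Y unknot 0 ∧ IsIntegralSurgery (𝓡 3) Y K' 0 ∧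
          K'.HasRasmussenInvariant s ∧ s ≠ 0 := by
  rintro ⟨K', Y, _, _, s, hU, hK', hs, hs0⟩
  exact hs0 (hR hs ((hPR K' Y hU hK').isSmoothlySlice Knot.IsSmoothlySlice.of_isIsotopic_holds))


/-- **Amphichiral partners are dead** (mod single-valuedness of `s`: the named facts `Knot.reidemeister` and
`GaussDiagram.rasmussenInvariant_eq_of_equiv`; existence, mirror and isotopy transport are PROVED): if `K'` is
isotopic to its mirror image then every Rasmussen invariant of `K'` vanishes (`s(K̄') = -s(K')`). So a search
discards amphichiral partners outright — whatever their 0-surgery (cf. Kegel–Spreer 2026 p. 4: chiral knots that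
are 0-friends of their mirrors, e.g. `K13n469`, are a different matter). [cite: Rasmussen2010, §3.5] -/
theorem rasmussen_eq_zero_of_amphichiral (hR : Knot.reidemeister) (hinv : GaussDiagram.rasmussenInvariant_eq_of_equiv)
    {K' : Knot} (hamph : K'.IsIsotopic K'.mirror) {s : ℤ} (hs : K'.HasRasmussenInvariant s) : s = 0 := by
  have hs' : K'.HasRasmussenInvariant (-s) := (HasRasmussenInvariant.mirror_holds hs).of_isIsotopic hamph
  have := (Knot.existsUnique_hasRasmussenInvariant Knot.exists_hasGaussDiagram_of_isIsotopic_holds hR hinv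
    K').unique hs hs'
  omega

/-- Hence **the partner of a witness is chiral** (mod single-valuedness of `s`). [cite: Rasmussen2010, §3.5] -/
theorem crux_partner_chiral (hR : Knot.reidemeister) (hinv : GaussDiagram.rasmussenInvariant_eq_of_equiv)
    {K' : Knot} {s : ℤ} (hs : K'.HasRasmussenInvariant s) (hs0 : s ≠ 0) : ¬ K'.IsIsotopic K'.mirror :=
  fun hamph ↦ hs0 (rasmussen_eq_zero_of_amphichiral hR hinv hamph hs)

end Summit.SmoothPoincare4.SmoothPoincare4.Theorems.ZseCruxRasmussen.Negative

end
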